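import Literature.NumberTheory.EllipticCurves.FineSelmerQuadraticLayerProofs
import Literature.NumberTheory.EllipticCurves.SelmerGroupOverBaseChangeModel
import Literature.NumberTheory.EllipticCurves.GeomPointsGaloisModule
import Mathlib.NumberTheory.NumberField.Completion.InfinitePlace
import HarnessLib

/-!
# The fine Selmer group under base change `L/K` at an infinite level: `x ∈ Sel₀(L̄^{H′}, E_L[p^∞])` iff its
# subgroup model `subgroupModelIso x ∈ H¹(galImage H′, E[p^∞])` is locally trivial at every prime of `K̄`
# (`H′ = Gal(L̄/L_∞)`, `L` totally complex) — THEOREMS only; no definition, no named fact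

The fine (everywhere locally trivial) companion of cell `bsd-2adic`'s Selmer base change
(`SelmerGroupOverBaseChangeModel`, t42 p701196: `subgroupModelIso : H¹(H′, E_L[p^∞]) ≃+ H¹(galImage H′, E[p^∞])`,
`galImage H′ = res(H′) ≤ Γ_K`, `conj`-equivariant).  For the FINE local conditions no local fields are needed: a class is
fine iff its cocycle is a coboundary on `H′ ⊓ D_𝔔` for EVERY maximal ideal `𝔔` of `\bar ℤ_L` (tree
`FineSelmerDevissage.exists_eq_smul_sub_of_mem_fineSelmerInfty`, `FineQuadraticLayer.mem_fineSelmerInfty_of_forall_prime`),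
and the decomposition groups correspond under restriction, `res⁻¹(D_{𝔔 ∩ \bar ℤ_K}) = D_𝔔` (tree
`comap_decompositionSubgroup_comap_absIntegersMap`, `\bar ℤ_K ≅ \bar ℤ_L`).  Hence:

* §1 archimedean places: `Γ_F` is trivial for `F` algebraically closed, so `D_w = 1` at a COMPLEX place `w` and every
  class restricts to zero on `H ⊓ D_w` (`subgroupH1_inf_decompInf_eq_zero_of_isComplex`).
* §2 **`forall_prime_subgroupModelIso_of_mem_fineSelmerInfty`**: a fine class over `L̄^{ker κ_L}` has subgroup model
  locally trivial at every prime of `K̄`; **`mem_fineSelmerInfty_of_forall_prime_subgroupModelIso`**: the converse for `L`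
  totally complex; packaged `mem_fineSelmerInfty_iff_forall_prime_subgroupModelIso`.

Everything is proved. Motivation (seat `conv-1` GEN 32, crux stmt-BirchSwinnertonDyer-19556, binder (S) `LambdaShapiroFineAtTwo`):
`K = ℚ`, `L` imaginary quadratic, `p = 2`; combined with `FineSelmerQuadraticLayerProofs` it identifies the genuine
`Sel₀(E/L_∞)` with the target of the fine `±`-decomposition. That assembly is NOT made here.

## References

* [SerreGaloisCohomology1997] J.-P. Serre, *Galois Cohomology*, I.§2.4–2.5, II.§1.1.
* [GreenbergLNM1716] R. Greenberg, LNM 1716 (1999), §2 (Selmer groups over infinite extensions; all primes above `v`).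
* [CoatesSujatha2005] J. Coates, R. Sujatha, Math. Ann. 331 (2005), §3 (fine Selmer group; Lemma 3.3 restriction).
* [NeukirchANT1999] J. Neukirch, *Algebraic Number Theory*, Ch. I §9 ((9.1)–(9.5)).
-/

set_option autoImplicit false

noncomputable section

open scoped Classical Pointwise

namespace Literature.NumberTheory.EllipticCurves

namespace FineBaseChangeModel

open NumberField IsDedekindDomain Field _root_.WeierstrassCurve
open Literature.NumberTheory.EllipticCurves.GreenbergSelmer Literature.NumberTheory.GaloisRepresentations
  Literature.NumberTheory.EllipticCurves.FineSelmerDevissage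
  Literature.NumberTheory.EllipticCurves.FineQuadraticLayer
  Literature.NumberTheory.EllipticCurves.CocycleCriteria
  Literature.NumberTheory.EllipticCurves.BaseChangeModel

/-! ## §1 Complex places impose no condition -/

section Archimedean

/-- **The absolute Galois group of an algebraically closed field is trivial** (`F̄ = F`).
[cite: SerreGaloisCohomology1997, I.§2.4] -/
theorem subsingleton_absoluteGaloisGroup_of_isAlgClosed (F : Type) [Field F] [IsAlgClosed F] :
    Subsingleton (absoluteGaloisGroup F) := by
  refine ⟨fun σ τ ↦ AlgEquiv.ext fun x ↦ ?_⟩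
  obtain ⟨a, rfl⟩ := (IsAlgClosed.algebraMap_bijective_of_isIntegral (k := F) (K := AlgebraicClosure F)).2 x
  rw [AlgEquiv.commutes, AlgEquiv.commutes]

variable {L : Type} [Field L] [NumberField L]

omit [NumberField L] in
/-- **At a complex place the decomposition group is trivial**: `L_w ≅ ℂ` is algebraically closed.
[cite: SerreGaloisCohomology1997, II.§1.1] -/
theorem decompInf_eq_bot_of_isComplex (w : InfinitePlace L) (hw : w.IsComplex) : decompInf w = ⊥ := by
  haveI : IsAlgClosed w.Completion :=
    IsAlgClosed.of_ringEquiv ℂ w.Completion (InfinitePlace.Completion.ringEquivComplexOfIsComplex hw).symm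
  haveI := subsingleton_absoluteGaloisGroup_of_isAlgClosed w.Completion
  rw [eq_bot_iff]
  rintro g ⟨τ, rfl⟩
  rw [Subsingleton.elim τ 1, map_one]
  exact (⊥ : Subgroup (absoluteGaloisGroup L)).one_mem

variable {M : Type} [AddCommGroup M] [DistribMulAction (absoluteGaloisGroup L) M] [TopologicalSpace M] [DiscreteTopology M]

omit [NumberField L] in
/-- **Every class of `H¹(H ⊓ D_w, M)` vanishes at a complex place `w`** (the group is trivial; a cocycle vanishes at `1`).
[cite: SerreGaloisCohomology1997, I.§2.4] -/
theorem subgroupH1_inf_decompInf_eq_zero_of_isComplex (H : Subgroup (absoluteGaloisGroup L)) (w : InfinitePlace L)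
    (hw : w.IsComplex) (ξ : subgroupH1 (H ⊓ decompInf w) M) : ξ = 0 := by
  obtain ⟨z, rfl⟩ := oneCocycleClass_surjective _ ξ
  refine (oneCocycleClass_eq_zero_iff _ z).2 ⟨0, fun g ↦ ?_⟩
  have hg : g = 1 := by
    apply Subtype.ext
    have h := (decompInf_eq_bot_of_isComplex w hw).le (Subgroup.mem_inf.1 g.2).2
    rw [Subgroup.mem_bot] at h
    exact h
  rw [hg, cocycle_one]
  change (0 : M) = (1 : ↥(H ⊓ decompInf w)) • (0 : M) - 0
  rw [smul_zero, sub_zero]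

end Archimedean

/-! ## §2 The fine conditions under the subgroup model -/

section Model

variable {K : Type} [Field K] {L : Type} [Field L] [NumberField L] [Algebra K L] [Algebra.IsAlgebraic K L]
  (W : WeierstrassCurve K) {p : ℕ} [Fact p.Prime] (κL : ZpExtension L p)

omit [NumberField L] in
/-- `𝔔 ↦ 𝔔 ∩ \bar ℤ_K` hits every maximal ideal of `\bar ℤ_K` (`\bar ℤ_K ≅ \bar ℤ_L`), with maximal preimage.
[cite: NeukirchANT1999, Ch. I §9 Prop. (9.1)] -/
theorem exists_isMaximal_comap_absIntegersMap_eq (𝔓 : Ideal (absIntegers (𝓞 K) K)) [𝔓.IsMaximal] :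
    ∃ (𝔔 : Ideal (absIntegers (𝓞 L) L)), 𝔔.IsMaximal ∧ 𝔔.comap (absIntegersMap K L) = 𝔓 := by
  let e : absIntegers (𝓞 K) K ≃+* absIntegers (𝓞 L) L := absIntegersEquiv K L
  refine ⟨𝔓.map (e : absIntegers (𝓞 K) K →+* absIntegers (𝓞 L) L), Ideal.map_isMaximal_of_equiv e, ?_⟩
  rw [← coe_absIntegersEquiv]
  exact Ideal.comap_map_of_bijective _ e.bijective

/-- **A fine class has subgroup model locally trivial at every prime of `K̄`.** For `x ∈ Sel₀(L̄^{ker κ_L}, E_L[p^∞])`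
and every maximal ideal `𝔓` of `\bar ℤ_K`, `subgroupModelIso x` restricts to zero on `galImage(ker κ_L) ⊓ D_𝔓`: with
`𝔔 ⊂ \bar ℤ_L` over `𝔓`, `res⁻¹(D_𝔓) = D_𝔔` and the cocycle of `x` is a coboundary on `ker κ_L ⊓ D_𝔔`.
[cite: CoatesSujatha2005, §3 (Lemma 3.3)] [cite: SerreGaloisCohomology1997, I.§2.4–2.5, II.§1.1] -/
theorem forall_prime_subgroupModelIso_of_mem_fineSelmerInfty {x : (W.baseChange L).subgroupH1 p κL.kerSubgroup}
    (hx : x ∈ (W.baseChange L).fineSelmerInfty κL) (𝔓 : Ideal (absIntegers (𝓞 K) K)) [𝔓.IsMaximal] :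
    W.resOfLe p (inf_le_left : galImage K L κL.kerSubgroup ⊓ 𝔓.decompositionSubgroup (absoluteGaloisGroup K) ≤
      galImage K L κL.kerSubgroup) (subgroupModelIso K L κL.kerSubgroup W p x) = 0 := by
  obtain ⟨𝔔, h𝔔, h𝔔𝔓⟩ := exists_isMaximal_comap_absIntegersMap_eq (K := K) (L := L) 𝔓
  haveI := h𝔔
  obtain ⟨y, rfl⟩ := oneCocycleClass_surjective _ x
  obtain ⟨b, hb⟩ := exists_eq_smul_sub_of_mem_fineSelmerInfty κL y hx 𝔔
  rw [subgroupModelIso_apply, resH1Hom_oneCocycleClass]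
  refine (CocycleCriteria.resOfLe_oneCocycleClass_eq_zero_iff _ _).2 ⟨(primaryBaseChangeEquiv L W p).symm b, fun n ↦ ?_⟩
  obtain ⟨hnH, hnD⟩ := Subgroup.mem_inf.1 n.2
  set σ : κL.kerSubgroup := ofGalImage K L κL.kerSubgroup ⟨n, hnH⟩ with hσ
  -- `σ ∈ D_𝔔` since `res σ = n ∈ D_𝔓 = D_{𝔔 ∩ \bar ℤ_K}`
  have hσD : (σ : absoluteGaloisGroup L) ∈ 𝔔.decompositionSubgroup (absoluteGaloisGroup L) := by
    rw [← comap_decompositionSubgroup_comap_absIntegersMap K L 𝔔, Subgroup.mem_comap, h𝔔𝔓]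
    change absGaloisRestrict K L (σ : absoluteGaloisGroup L) ∈ _
    rw [← resGal_eq_absGaloisRestrict, hσ, resGal_ofGalImage]
    exact hnD
  rw [pullback_resHomOfEquivariant_apply]
  change (primaryBaseChangeEquiv L W p).symm (y.1 (ofGalImage K L κL.kerSubgroup (Subgroup.inclusion _ n))) = _
  have hincl : ofGalImage K L κL.kerSubgroup (Subgroup.inclusion
      (inf_le_left : galImage K L κL.kerSubgroup ⊓ 𝔓.decompositionSubgroup (absoluteGaloisGroup K) ≤
        galImage K L κL.kerSubgroup) n) = σ := by
    rw [hσ]; rfl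
  rw [hincl, hb σ hσD, map_sub]
  change (primaryBaseChangeEquiv L W p).symm (σ • b) - _ = _
  rw [primaryBaseChangeEquiv_symm_smul_ofGalImage]
  rfl

/-- **Conversely, for `L` totally complex**: if `subgroupModelIso x` restricts to zero on `galImage(ker κ_L) ⊓ D_𝔓` for every
maximal `𝔓 ⊂ \bar ℤ_K`, then `x ∈ Sel₀(L̄^{ker κ_L}, E_L[p^∞])` — the finite places by `res⁻¹(D_{𝔔 ∩ \bar ℤ_K}) = D_𝔔` and
transport back along `toGalImage`, the (complex) archimedean places impose nothing (§1).
[cite: CoatesSujatha2005, §3 (Lemma 3.3)] [cite: SerreGaloisCohomology1997, I.§2.4–2.5, II.§1.1] -/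
theorem mem_fineSelmerInfty_of_forall_prime_subgroupModelIso (hL : ∀ w : InfinitePlace L, w.IsComplex)
    (x : (W.baseChange L).subgroupH1 p κL.kerSubgroup)
    (hx : ∀ (𝔓 : Ideal (absIntegers (𝓞 K) K)), 𝔓.IsMaximal →
      W.resOfLe p (inf_le_left : galImage K L κL.kerSubgroup ⊓ 𝔓.decompositionSubgroup (absoluteGaloisGroup K) ≤
        galImage K L κL.kerSubgroup) (subgroupModelIso K L κL.kerSubgroup W p x) = 0) :
    x ∈ (W.baseChange L).fineSelmerInfty κL := by
  refine mem_fineSelmerInfty_of_forall_prime κL x (fun 𝔔 h𝔔 ↦ ?_)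
    (fun w σ ↦ subgroupH1_inf_decompInf_eq_zero_of_isComplex _ w (hL w) _)
  -- the prime `𝔓 = 𝔔 ∩ \bar ℤ_K` below `𝔔`
  set 𝔓 : Ideal (absIntegers (𝓞 K) K) := 𝔔.comap (absIntegersMap K L) with h𝔓
  haveI : 𝔓.IsMaximal := Ideal.comap_isMaximal_of_surjective _ (absIntegersMap_surjective K L)
  obtain ⟨y, rfl⟩ := oneCocycleClass_surjective _ x
  have h := hx 𝔓 inferInstance
  rw [subgroupModelIso_apply, resH1Hom_oneCocycleClass] at h
  obtain ⟨a, ha⟩ := (CocycleCriteria.resOfLe_oneCocycleClass_eq_zero_iff _ _).1 h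
  refine (CocycleCriteria.resOfLe_oneCocycleClass_eq_zero_iff _ _).2 ⟨primaryBaseChangeEquiv L W p a, fun σ ↦ ?_⟩
  obtain ⟨hσH, hσD⟩ := Subgroup.mem_inf.1 σ.2
  -- `res σ ∈ galImage(ker κ_L) ⊓ D_𝔓`
  have hnD : resGal (K := K) L (σ : absoluteGaloisGroup L) ∈ 𝔓.decompositionSubgroup (absoluteGaloisGroup K) := by
    have h1 : (σ : absoluteGaloisGroup L) ∈ (𝔓.decompositionSubgroup (absoluteGaloisGroup K)).comap
        (absGaloisRestrict K L).toMonoidHom := by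
      rw [h𝔓, comap_decompositionSubgroup_comap_absIntegersMap K L 𝔔]; exact hσD
    rw [Subgroup.mem_comap] at h1
    rw [resGal_eq_absGaloisRestrict]; exact h1
  let n : ↥(galImage K L κL.kerSubgroup ⊓ 𝔓.decompositionSubgroup (absoluteGaloisGroup K)) :=
    ⟨resGal (K := K) L (σ : absoluteGaloisGroup L), Subgroup.mem_inf.2 ⟨⟨σ, hσH, rfl⟩, hnD⟩⟩
  have hn := ha n
  rw [pullback_resHomOfEquivariant_apply] at hn
  have hofGal : ofGalImage K L κL.kerSubgroup (Subgroup.inclusion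
      (inf_le_left : galImage K L κL.kerSubgroup ⊓ 𝔓.decompositionSubgroup (absoluteGaloisGroup K) ≤
        galImage K L κL.kerSubgroup) n) = Subgroup.inclusion
        (inf_le_left : κL.kerSubgroup ⊓ 𝔔.decompositionSubgroup (absoluteGaloisGroup L) ≤ κL.kerSubgroup) σ := by
    have : Subgroup.inclusion (inf_le_left : galImage K L κL.kerSubgroup ⊓
        𝔓.decompositionSubgroup (absoluteGaloisGroup K) ≤ galImage K L κL.kerSubgroup) n =
        toGalImage K L κL.kerSubgroup (Subgroup.inclusion
          (inf_le_left : κL.kerSubgroup ⊓ 𝔔.decompositionSubgroup (absoluteGaloisGroup L) ≤ κL.kerSubgroup) σ) :=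
      Subtype.ext rfl
    rw [this, ofGalImage_toGalImage]
  change (primaryBaseChangeEquiv L W p).symm (y.1 (ofGalImage K L κL.kerSubgroup (Subgroup.inclusion _ n))) = _ at hn
  rw [hofGal] at hn
  -- apply `e = primaryBaseChangeEquiv`
  have hn' := congrArg (primaryBaseChangeEquiv L W p) hn
  rw [AddEquiv.apply_symm_apply, map_sub] at hn'
  rw [hn']
  congr 1
  have hsmul := primaryBaseChangeEquiv_smul_toGalImage K L κL.kerSubgroup W p (Subgroup.inclusion
    (inf_le_left : κL.kerSubgroup ⊓ 𝔔.decompositionSubgroup (absoluteGaloisGroup L) ≤ κL.kerSubgroup) σ) a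
  rw [Subgroup.smul_def, coe_toGalImage, Subgroup.smul_def] at hsmul
  exact hsmul

/-- **`x ∈ Sel₀(L̄^{ker κ_L}, E_L[p^∞]) ↔ subgroupModelIso x` is locally trivial at every prime of `K̄`** (`L` totally complex).
[cite: CoatesSujatha2005, §3 (Lemma 3.3)] [cite: GreenbergLNM1716, §2] -/
theorem mem_fineSelmerInfty_iff_forall_prime_subgroupModelIso (hL : ∀ w : InfinitePlace L, w.IsComplex)
    (x : (W.baseChange L).subgroupH1 p κL.kerSubgroup) :
    x ∈ (W.baseChange L).fineSelmerInfty κL ↔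
      ∀ (𝔓 : Ideal (absIntegers (𝓞 K) K)), 𝔓.IsMaximal →
        W.resOfLe p (inf_le_left : galImage K L κL.kerSubgroup ⊓ 𝔓.decompositionSubgroup (absoluteGaloisGroup K) ≤
          galImage K L κL.kerSubgroup) (subgroupModelIso K L κL.kerSubgroup W p x) = 0 :=
  ⟨fun hx 𝔓 _ ↦ forall_prime_subgroupModelIso_of_mem_fineSelmerInfty W κL hx 𝔓,
    mem_fineSelmerInfty_of_forall_prime_subgroupModelIso W κL hL x⟩

end Model

end FineBaseChangeModel

end Literature.NumberTheory.EllipticCurves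

end
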